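import Literature.Topology.FourManifolds.K2LiteUpGen
import HarnessLib

/-!
# The reflected band-coordinate K₂ track of the upper arch with a free approach width

Topic `Literature/Topology/FourManifolds`; fact seat `provefact-IsStrictHandleSlide.isSurgery`
(R. C. Kirby, *The Topology of 4-Manifolds*, LNM 1374 (1989), Ch. I §4, Fig. 4.2; remaining content:
the named fact (S) `Literature.Topology.FourManifolds.FramedLink.IsStrictHandleSlide.slideModel`).
The upper-arch analogue of `K2LiteBandGen2.lean`: approach levels `hr1 = fUpR (…) + 3/20 - μ`,
`hr0 = hr1 - μ` with `0 < μ ≤ 1/100` (`BandCore.liteHr1μU`), the speed bound `liteVminU2 μ`, slope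
`liteMsU2 μ`, the reflected track data `BandCore.k2liteUpGen2` and its reshaping isotopy
`BandCore.exists_ambientIsotopy_k2liteUpGen2`.

## References

* R. C. Kirby, *The Topology of 4-Manifolds*, LNM 1374, Springer (1989), Ch. I §4. [Kirby1989]
-/

open scoped Manifold ContDiff Topology
open Set Real Filter Function

noncomputable section

namespace Literature.Topology.FourManifolds

namespace BandCore

variable {A B : Knot} {avoid : Set (Metric.sphere (0 : EuclideanSpace ℝ (Fin 4)) 1)} (c : BandCore A B avoid)

/-- The upper level of the approach step of width `μ` for the upper arch. [folklore] -/
def liteHr1μU (μ : ℝ) : ℝ := c.fUpR (-c.thi - c.epsHi - c.epsHi / 2) + 3 / 20 - μ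

/-- `liteHrμU_lt` (auxiliary). [folklore] -/
theorem liteHrμU_lt {μ : ℝ} (hμ : 0 < μ) : c.liteHr1μU μ - μ < c.liteHr1μU μ := by linarith

/-- A positive lower bound of the abscissa speed of the reflected upper track on the landing levels.
[folklore] -/
theorem exists_liteVminU2 {μ : ℝ} (hμ : 0 < μ) : ∃ v : ℝ, 0 < v ∧ ∀ τ ∈ Icc (-c.thi - c.epsHi - c.epsHi) (-c.thi - c.epsHi - c.epsHi / 2),
    smoothStep (c.liteHr1μU μ - μ) (c.liteHr1μU μ) (c.liteHhU τ) ∈ Icc (8⁻¹ : ℝ) (7 / 8) →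
    v ≤ deriv (smoothStep (c.liteHr1μU μ - μ) (c.liteHr1μU μ)) (c.liteHhU τ) * deriv c.fUpR τ := by
  have hε := c.epsHi_bounds.1
  set F : ℝ → ℝ := fun t ↦ deriv (smoothStep (c.liteHr1μU μ - μ) (c.liteHr1μU μ)) (c.liteHhU t) * deriv c.fUpR t with hF
  have hFc : Continuous F :=
    (((contDiff_smoothStep _ _).continuous_deriv (by simp)).comp c.continuous_liteHhU).mul
      (c.contDiff_fUpR.continuous_deriv (by simp))
  set Z : Set ℝ := {t ∈ Icc (-c.thi - c.epsHi - c.epsHi) (-c.thi - c.epsHi - c.epsHi / 2) |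
    smoothStep (c.liteHr1μU μ - μ) (c.liteHr1μU μ) (c.liteHhU t) ∈ Icc (8⁻¹ : ℝ) (7 / 8)} with hZ
  have hZc : IsCompact Z := by
    refine isCompact_Icc.inter_right ?_
    exact isClosed_Icc.preimage ((continuous_smoothStep _ _).comp c.continuous_liteHhU)
  have hFpos : ∀ t ∈ Z, 0 < F t := by
    rintro t ⟨ht, hS⟩
    have hf : 0 < deriv c.fUpR t := c.deriv_fUpR_pos (by linarith [ht.2])
    have hin : c.liteHhU t ∈ Ioo (c.liteHr1μU μ - μ) (c.liteHr1μU μ) := by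
      constructor
      · by_contra h; rw [smoothStep_of_le (c.liteHrμU_lt hμ) (le_of_not_gt h)] at hS; norm_num at hS
      · by_contra h; rw [smoothStep_of_ge (c.liteHrμU_lt hμ) (le_of_not_gt h)] at hS; norm_num at hS
    exact mul_pos (deriv_smoothStep_pos (c.liteHrμU_lt hμ) hin) hf
  by_cases hne : Z.Nonempty
  · obtain ⟨t₀, ht₀, hmin⟩ := hZc.exists_isMinOn hne hFc.continuousOn
    exact ⟨F t₀, hFpos t₀ ht₀, fun t ht hS ↦ hmin ⟨ht, hS⟩⟩
  · refine ⟨1, one_pos, fun t ht hS ↦ ?_⟩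
    exact absurd ⟨t, ht, hS⟩ hne

/-- `liteVminU2` (auxiliary). [folklore] -/
def liteVminU2 {μ : ℝ} (hμ : 0 < μ) : ℝ := Classical.choose (c.exists_liteVminU2 hμ)

/-- `liteVminU2_spec` (auxiliary). [folklore] -/
theorem liteVminU2_spec {μ : ℝ} (hμ : 0 < μ) : 0 < c.liteVminU2 hμ ∧ ∀ τ ∈ Icc (-c.thi - c.epsHi - c.epsHi) (-c.thi - c.epsHi - c.epsHi / 2),
    smoothStep (c.liteHr1μU μ - μ) (c.liteHr1μU μ) (c.liteHhU τ) ∈ Icc (8⁻¹ : ℝ) (7 / 8) →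
    c.liteVminU2 hμ ≤ deriv (smoothStep (c.liteHr1μU μ - μ) (c.liteHr1μU μ)) (c.liteHhU τ) * deriv c.fUpR τ :=
  Classical.choose_spec (c.exists_liteVminU2 hμ)

/-- `m_s = 2 M_H / v_min` for the width `μ` (upper arch). [folklore] -/
def liteMsU2 {μ : ℝ} (hμ : 0 < μ) : ℝ := 2 * c.liteMHU / c.liteVminU2 hμ

/-- `liteMsU2_pos` (auxiliary). [folklore] -/
theorem liteMsU2_pos {μ : ℝ} (hμ : 0 < μ) : 0 < c.liteMsU2 hμ := div_pos (by linarith [c.liteMHU_pos]) (c.liteVminU2_spec hμ).1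

/-- `liteMsU2_mul` (auxiliary). [folklore] -/
theorem liteMsU2_mul {μ : ℝ} (hμ : 0 < μ) : c.liteMsU2 hμ * c.liteVminU2 hμ = 2 * c.liteMHU := by
  rw [liteMsU2]; field_simp [(c.liteVminU2_spec hμ).1.ne']

/-! ### The reflected track data of the upper arch, free approach width -/

/-- **The band-coordinate upper track data** (reflected). [cite: Kirby1989, Ch. I §4] -/
def k2liteUpGen2 {μ ms κD εℓ u₁ : ℝ} (hμ : 0 < μ) (hμ' : μ ≤ 100⁻¹) (hms : c.liteMsU2 hμ ≤ ms) (hκ : 0 < κD) (hκ' : κD ≤ liteKmaxGen ms)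
    (hε : 0 < εℓ) (hε' : 4 * εℓ ≤ κD) (hu : 0 < u₁) (hu' : u₁ ≤ κD) : K2LiteData where
  a := -c.ahi + c.epsHi
  b := -c.thi - c.epsHi
  ε := c.epsHi
  f := c.fUpR
  g := c.gUpR
  ch := 3 / 20
  κ₀ := 2⁻¹
  hpl := (c.fUpR (-c.ahi + c.epsHi) + c.fUpR (-c.thi - c.epsHi - c.epsHi)) / 2
  hr0 := c.liteHr1μU μ - μ
  hr1 := c.liteHr1μU μ
  κD := κD
  εℓ := εℓ
  u₁ := u₁
  ms := ms
  vmin := c.liteVminU2 hμ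
  MH := c.liteMHU
  ε_pos := c.epsHi_bounds.1
  hab := by linarith [c.thi_add_lt_ahi_sub]
  f_smooth := c.contDiff_fUpR
  g_smooth := c.contDiff_gUpR
  f_deriv_pos := fun τ hτ ↦ c.deriv_fUpR_pos (by linarith)
  g_deriv_neg := fun τ hτ ↦ by
    rw [c.deriv_gUpR]
    exact c.gUp_spec.2.2.1 (-τ) (by linarith [c.thi_marksB.2])
  ch_pos := by norm_num
  κ₀_pos := by norm_num
  κ₀_le := le_rfl
  hpl_gt := by
    have := c.fUpR_lt_fUpR (show -c.ahi + c.epsHi < -c.thi - c.epsHi - c.epsHi by linarith [c.thi_add_lt_ahi_sub, c.epsHi_bounds.1])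
      (by linarith [c.epsHi_bounds.1])
    linarith
  hpl_le := by
    have h1 := c.fUpR_lt_fUpR (show -c.ahi + c.epsHi < -c.thi - c.epsHi - c.epsHi by linarith [c.thi_add_lt_ahi_sub, c.epsHi_bounds.1])
      (by linarith [c.epsHi_bounds.1])
    have h2 := c.fUpR_le_fUpR (show -c.thi - c.epsHi - c.epsHi ≤ -c.thi - c.epsHi - c.epsHi / 2 by linarith [c.epsHi_bounds.1])
      (by linarith [c.epsHi_bounds.1])
    rw [liteHr1μU]; linarith
  hr0_gt := by
    have h2 := c.fUpR_le_fUpR (show -c.thi - c.epsHi - c.epsHi ≤ -c.thi - c.epsHi - c.epsHi / 2 by linarith [c.epsHi_bounds.1])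
      (by linarith [c.epsHi_bounds.1])
    rw [liteHr1μU]; linarith
  hr_lt := c.liteHrμU_lt hμ
  hr1_le := by rw [liteHr1μU]; linarith
  κD_pos := hκ
  κD_le := by linarith [hκ'.trans (liteKmaxGen_le ms)]
  κD_small := by linarith [hκ'.trans (liteKmaxGen_le ms)]
  εℓ_pos := hε
  εℓ_le := hε'
  u₁_pos := hu
  u₁_le := hu'
  ms_pos := (c.liteMsU2_pos hμ).trans_le hms
  vmin_pos := (c.liteVminU2_spec hμ).1
  vmin_le := fun t ht hS ↦ (c.liteVminU2_spec hμ).2 t ht (by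
    have hk := hκ'.trans (liteKmaxGen_le ms)
    have e : c.liteHhU t = c.fUpR t + 3 / 20 * smoothStep (-c.thi - c.epsHi - c.epsHi) (-c.thi - c.epsHi - c.epsHi / 2) t := rfl
    rw [e]
    exact ⟨by linarith [hS.1], by linarith [hS.2]⟩)
  MH_ge := c.liteMHU_spec
  ms_large := by
    have h := c.liteMsU2_mul hμ
    nlinarith [mul_le_mul_of_nonneg_right hms (c.liteVminU2_spec hμ).1.le]
  f_lo := fun τ hτ ↦ by
    have := (c.fUpR_mem_window (τ := τ) ⟨by linarith [hτ.1, c.epsHi_bounds.1], by linarith [hτ.2]⟩).1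
    linarith
  f_hi := fun τ hτ ↦ by
    have := (c.fUpR_mem_window (τ := τ) ⟨by linarith [hτ.1, c.epsHi_bounds.1], by linarith [hτ.2]⟩).2
    linarith
  g_mem := fun τ hτ ↦ by
    have h := c.gUp_mem (t := -τ) (by linarith [hτ.2, c.thi_marksB.1])
    show 1 - c.gUp (-τ) ∈ _
    exact ⟨by linarith [h.2], by linarith [h.1]⟩
  gap := fun τ hτ ↦ by
    have hg := c.gUpR_le_landing (τ := τ) ⟨hτ.1, by linarith [hτ.2]⟩
    have hf := (c.fUpR_mem_window (τ := -c.thi - c.epsHi - c.epsHi / 2)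
      ⟨by linarith [c.thi_add_lt_ahi_sub, c.epsHi_bounds.1], by linarith [c.epsHi_bounds.1]⟩).1
    have hmsp : 0 < ms := (c.liteMsU2_pos hμ).trans_le hms
    have hk : ms * κD ≤ 101⁻¹ := by
      have := hκ'.trans (liteKmaxGen_le' ms hmsp)
      rw [le_div_iff₀ hmsp] at this
      linarith
    rw [liteHr1μU]; linarith

section

variable {μ ms κD εℓ u₁ : ℝ} (hμ : 0 < μ) (hμ' : μ ≤ 100⁻¹) (hms : c.liteMsU2 hμ ≤ ms) (hκ : 0 < κD) (hκ' : κD ≤ liteKmaxGen ms)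
  (hε : 0 < εℓ) (hε' : 4 * εℓ ≤ κD) (hu : 0 < u₁) (hu' : u₁ ≤ κD)

/-- The abscissa of the upper arch is the reflected `smoothStep a b` of the track data. [folklore] -/
theorem cUp_fst_eq_gen2 (t : ℝ) :
    c.cUp t 0 = smoothStep (c.k2liteUpGen2 hμ hμ' hms hκ hκ' hε hε' hu hu').a (c.k2liteUpGen2 hμ hμ' hms hκ hκ' hε hε' hu hu').b (-t) := by
  rw [c.cUp_apply_zero']; rfl

/-- The height of the upper arch is `1 - v (-t)` for the reflected track data. [folklore] -/
theorem cUp_snd_eq_v_gen2 (t : ℝ) : c.cUp t 1 = 1 - (c.k2liteUpGen2 hμ hμ' hms hκ hκ' hε hε' hu hu').v (-t) := by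
  rw [c.cUp_apply_one', K2LiteData.v]
  have e1 : (c.k2liteUpGen2 hμ hμ' hms hκ hκ' hε hε' hu hu').a + (c.k2liteUpGen2 hμ hμ' hms hκ hκ' hε hε' hu hu').ε = -c.ahi + 2 * c.epsHi := by
    show -c.ahi + c.epsHi + c.epsHi = _; ring
  have e2 : (c.k2liteUpGen2 hμ hμ' hms hκ hκ' hε hε' hu hu').b - (c.k2liteUpGen2 hμ hμ' hms hκ hκ' hε hε' hu hu').ε = -c.thi - 2 * c.epsHi := by
    show -c.thi - c.epsHi - c.epsHi = _; ring
  rw [e1, e2]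
  show _ = 1 - ((1 - smoothStep (-c.ahi + 2 * c.epsHi) (-c.thi - 2 * c.epsHi) (-t)) * (1 - c.fUp (- -t)) +
    smoothStep (-c.ahi + 2 * c.epsHi) (-c.thi - 2 * c.epsHi) (-t) * (1 - c.gUp (- -t)))
  rw [neg_neg]; ring

/-- **The reshaping isotopy of the upper arch along the band-coordinate track.**
[cite: Kirby1989, Ch. I §4] -/
theorem exists_ambientIsotopy_k2liteUpGen2 (hAB : Disjoint (range ⇑A) (range ⇑B))
    {O : Set (Metric.sphere (0 : EuclideanSpace ℝ (Fin 4)) 1)} (hO : IsOpen O)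
    (hOsub : ∀ u ∈ Icc (0 : ℝ) 1, ∀ s ∈ Icc (c.thi + c.epsHi / 4) (c.ahi - c.epsHi / 2),
      c.band (pt2 ((1 - u) * c.cUp s 0 + u * (c.k2liteUpGen2 hμ hμ' hms hκ hκ' hε hε' hu hu').X₁ (-s))
        ((1 - u) * c.cUp s 1 + u * (1 - (c.k2liteUpGen2 hμ hμ' hms hκ hκ' hε hε' hu hu').H₁ (-s)))) ∈ O) :
    ∃ (Θ : AmbientIsotopy (𝓡 3) (Metric.sphere (0 : EuclideanSpace ℝ (Fin 4)) 1)) (k₂ : Knot),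
      (∀ t y, y ∉ O → Θ.toFun t y = y) ∧ Θ.toFun 1 ∘ ⇑(c.rebuild hAB) = ⇑k₂ ∧
      (∀ s ∈ Icc (c.thi + c.epsHi / 4) (c.ahi - c.epsHi / 2),
        k₂ (circlePt s) = c.band (pt2 ((c.k2liteUpGen2 hμ hμ' hms hκ hκ' hε hε' hu hu').X₁ (-s))
          (1 - (c.k2liteUpGen2 hμ hμ' hms hκ hκ' hε hε' hu hu').H₁ (-s)))) ∧
      (∀ t ∈ Ico c.alo (c.alo + 1), t ∉ Icc (c.thi + c.epsHi / 4) (c.ahi - c.epsHi / 2) →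
        k₂ (circlePt t) = c.rebuild hAB (circlePt t)) := by
  set d := c.k2liteUpGen2 hμ hμ' hms hκ hκ' hε hε' hu hu' with hd
  have hε0 := c.epsHi_bounds.1
  have hab := c.thi_add_lt_ahi_sub
  have ha : d.a = -c.ahi + c.epsHi := rfl
  have hb : d.b = -c.thi - c.epsHi := rfl
  have hεd : d.ε = c.epsHi := rfl
  have hf : ∀ τ, d.f τ = 1 - c.fUp (-τ) := fun τ ↦ rfl
  have hg : ∀ τ, d.g τ = 1 - c.gUp (-τ) := fun τ ↦ rfl
  have hI : ∀ {s}, s ∈ Icc (c.thi + c.epsHi / 4) (c.ahi - c.epsHi / 2) →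
      -s ∈ Icc (d.a - d.ε / 2) (d.b + 3 * d.ε / 4) := fun hs ↦ by
    rw [ha, hb, hεd]; exact ⟨by linarith [hs.2], by linarith [hs.1]⟩
  -- the reflected track functions and their derivatives
  set X₁ : ℝ → ℝ := fun t ↦ d.X₁ (-t) with hX₁
  set H₁ : ℝ → ℝ := fun t ↦ 1 - d.H₁ (-t) with hH₁
  have hX₁s : ContDiff ℝ ∞ X₁ := d.contDiff_X₁.comp contDiff_neg
  have hH₁s : ContDiff ℝ ∞ H₁ := contDiff_const.sub (d.contDiff_H₁.comp contDiff_neg)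
  have hdX : ∀ t, deriv X₁ t = -deriv d.X₁ (-t) := fun t ↦ by
    simp only [hX₁]; rw [deriv_comp_neg]
  have hdH : ∀ t, deriv H₁ t = deriv d.H₁ (-t) := fun t ↦ by
    simp only [hH₁]
    rw [deriv_const_sub, show (fun t ↦ d.H₁ (-t)) = fun t ↦ d.H₁ (-t) from rfl, deriv_comp_neg, neg_neg]
  refine c.exists_ambientIsotopy_upperTrack' hAB hX₁s hH₁s ?_ ?_ (fun t ↦ d.X₁_mem_Icc _) ?_ ?_ ?_ ?_ ?_ ?_ ?_ ?_ ?_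
    hO hOsub
  · -- hagreeX
    intro t ht
    rcases le_or_gt (c.ahi - c.epsHi) t with h | h
    · simp only [hX₁]; rw [d.X₁_of_le_a (by rw [ha]; linarith), c.cUp_fst_eq_zero_of_ge h]
    · have h2 : t ≤ c.thi + c.epsHi / 2 := by
        by_contra h2; exact ht ⟨lt_of_not_ge h2, h⟩
      simp only [hX₁]; rw [d.X₁_of_ge (by rw [hb, hεd]; linarith), c.cUp_fst_eq_one_of_le (by linarith)]
  · -- hagreeH
    intro t ht
    rcases le_or_gt (c.ahi - c.epsHi) t with h | h
    · simp only [hH₁]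
      rw [d.H₁_of_le_a (by rw [ha]; linarith), hf, neg_neg, c.cUp_snd_eq_fUp_of_ge (by linarith)]; ring
    · have h2 : t ≤ c.thi + c.epsHi / 2 := by
        by_contra h2; exact ht ⟨lt_of_not_ge h2, h⟩
      simp only [hH₁]
      rw [d.H₁_of_ge (by rw [hb, hεd]; linarith), hg, neg_neg, c.cUp_snd_eq_gUp_of_le (by linarith)]; ring
  · -- hdX₁ ≤ 0
    intro t; rw [hdX]; linarith [d.deriv_X₁_nonneg (-t)]
  · -- hX₁zero
    intro s _ h0
    have := d.le_a_of_X₁_eq_zero h0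
    simp only [hH₁]; rw [d.H₁_of_le_a this, hf, neg_neg]; ring
  · -- hX₁lt
    intro t ht
    exact d.X₁_lt_one_of_le (by rw [hb, hεd]; linarith)
  · -- hH₁I
    intro t ht
    have h := d.H₁_mem_Ioo (hI ht)
    simp only [hH₁]; exact ⟨by linarith [h.2], by linarith [h.1]⟩
  · -- hH₁le
    intro t ht hX
    have h := d.g_le_H₁ (t := -t) (by rw [hb, hεd]; exact ⟨by linarith [ht.2], by linarith [ht.1]⟩) hX
    rw [hg, neg_neg] at h
    simp only [hH₁]; linarith
  · -- hinj₁
    intro s hs t ht h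
    have h0 : X₁ s = X₁ t := by simpa using congrArg (fun p : EuclideanSpace ℝ (Fin 2) ↦ p 0) h
    have h1 : H₁ s = H₁ t := by simpa using congrArg (fun p : EuclideanSpace ℝ (Fin 2) ↦ p 1) h
    simp only [hX₁] at h0
    simp only [hH₁] at h1
    have := d.injOn_track (hI hs) (hI ht) (Prod.ext h0 (by linarith))
    linarith
  · -- hreg₁
    intro s hs hX
    rw [hdH]
    refine d.deriv_H₁_ne_zero (hI hs) ?_
    have := hdX s; rw [hX] at this; linarith
  · -- hco
    intro t ht t' ht' hlt h0 _
    rw [c.cUp_fst_eq_gen2 hμ hμ' hms hκ hκ' hε hε' hu hu', c.cUp_fst_eq_gen2 hμ hμ' hms hκ hκ' hε hε' hu hu'] at h0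
    have key := d.co_mono (hI ht') (hI ht) (by linarith) h0.symm
    rw [c.cUp_snd_eq_v_gen2 hμ hμ' hms hκ hκ' hε hε' hu hu', c.cUp_snd_eq_v_gen2 hμ hμ' hms hκ hκ' hε hε' hu hu']
    simp only [hH₁]
    rcases key with ⟨h1, h2⟩ | ⟨h1, h2⟩
    · left; exact ⟨by linarith, by linarith⟩
    · right; exact ⟨by linarith, by linarith⟩
  · -- hcoD
    intro s hs hχ' _
    have eχ : (fun t ↦ c.cUp t 0) = fun t ↦ smoothStep d.a d.b (-t) := funext fun t ↦ c.cUp_fst_eq_gen2 hμ hμ' hms hκ hκ' hε hε' hu hu' t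
    have ev : (fun t ↦ c.cUp t 1) = fun t ↦ 1 - d.v (-t) := funext fun t ↦ c.cUp_snd_eq_v_gen2 hμ hμ' hms hκ hκ' hε hε' hu hu' t
    rw [eχ, deriv_comp_neg, neg_eq_zero] at hχ'
    rw [ev, hdH, deriv_const_sub, deriv_comp_neg, neg_neg]
    exact d.co_monoD (hI hs) hχ'

end

end BandCore

end Literature.Topology.FourManifolds
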